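import Literature.Computability.AlgebraicComplexity.TangencyFlattening
import Literature.Computability.AlgebraicComplexity.KoszulYoungCertificate
import Literature.LinearAlgebra.Matrix.IntRowCertificateUnitPivot
import HarnessLib

/-!
# Integer certificates for the tangency-flattening LOWER bound on border rank, checked by `decide`

Topic `Literature/Computability/AlgebraicComplexity`; a trunk-independent TOOL, the third lower-bound
certificate kind next to `KoszulYoungCertificate.lean` (Koszul–Young `p = 1`, slice rank) and the
companion of `ApproxDecompositionCertificate.lean` (upper bounds).  Everything here is PROVED; nothing
is specific to one tensor.
HONEST FRAMING: the value is DECIDABLE VERDICTS / CERTIFICATES about explicit small tensors (the rows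
of the certificate tables that import this file), not progress on the exponent of matrix
multiplication.

The **tangency flattening** of Doležálek–Michałek (`TangencyFlattening.lean`): for
`t ∈ K^ι ⊗ K^κ ⊗ K^μ` the matrix `Tang(t)` with rows `ι³ × κ × μ`, columns `ι × κ × μ` and entries
`det [ t(·,b,c) ; t(·,b',c') ; e_d ]_S` satisfies `rank Tang(t) ≤ bR(t) (bR(t) - 1) (#ι - 2)`
(tree theorem `rank_tangencyFlattening_le_of_algBorderRank_le`, whence
`le_algBorderRank_of_lt_rank_tangencyFlattening : (R - 1) (R - 2) (#ι - 2) < rank Tang(t) → R ≤ bR(t)`;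
Doležálek–Michałek 2026, Cor. 3.9 and §5).  The bound is QUADRATIC in `bR`, so unlike the linear
(Koszul / flattening) rank methods it separates e.g. `bR = 6` from `7` on `4 × 4 × 4` formats
(`Tang` has `4³·16 = 1024` rows and `64` columns there; `rank ≥ 61 ⇒ bR ≥ 7`, `rank ≥ 41 ⇒ bR ≥ 6`).

This file packages the flattening as a closed integer computation on row/column CODES:
`TanCert.tanEntry n a b c sel T r q` is the entry of `Tang` of the integer tensor `T : Fin a → Fin b → Fin c → ℤ`
with its FIRST factor restricted to the `n` selected slices `sel` (restriction can only lower the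
border rank, `algBorderRank_precomp_le`), at row code
`r = (((s₁ n + s₂) n + s₃) b + j) c + l'` and column code `q = (d b + j') c + l`
(`TanCert.rowDec`, `TanCert.colDec`).  `TanCert.le_algBorderRank_of_tanCheck` says: an integer row
certificate (`intTriCheck`, `LinearAlgebra/Matrix/IntRowCertificate.lean`) for `rank ≥ m` together with
`(R - 1) (R - 2) (n - 2) < m` gives `R ≤ bR(T ⊗ K)` for every field `K` of characteristic zero;
`…Unit` (unit pivots, `intTriCheckUnit`) gives it over every field.  For SPEED in the kernel the tables
use the dense form `TanCert.tanEntryL n b c Tl` in which the restricted tensor is read positionally from a list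
`Tl : List ℤ` of length `n b c` (`TanCert.denseT`; one `List.getD` per tensor access instead of a search through
`((i,j,l), value)` entries), with the pointwise agreement `denseT n b c Tl x j l = T (sel[x]) j l` as a separate
`decide`d hypothesis of `TanCert.le_algBorderRank_of_tanCheckL(Unit)`.  The other two distinguished factors are
reached through `KYCert.le_algBorderRank_of_rotate₁/₂`.  Certificates (the selection, the
row combinations and pivots) are found outside Lean by exact elimination over `ℚ`; only their
verification is in the kernel.  The worked instance `Tang(M⟨2⟩)` of full rank `64` (hence `bR(M⟨2⟩) = 7`)
is `TangencyFlatteningMatMulTwo.lean`; clients: the border-rank certificate tables of the pub-tensor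
bundle (`SmallTensorBorderRank*.lean`).

## References

* M. Doležálek, M. Michałek, *Nonlinear methods for tensors: determinantal equations for secant
  varieties beyond cactus* (2026), arXiv:2602.12762 — §3 (the flattening), Cor. 3.9
  (`rank Tang(t) ≤ bR (bR - 1)(dim V₁ - 2)`), §5 (`bR(M⟨2⟩) = 7`). [DolezalekMichalek2026]
* M. Bläser, *Fast Matrix Multiplication*, Theory of Computing Graduate Surveys 5 (2013), §5.1
  (permutations / restrictions of tensors), Def. 6.1 (border rank). [Blaser2013]
-/

set_option autoImplicit false

open scoped BigOperators Matrix
open Matrix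

namespace Literature.Computability.AlgebraicComplexity

open Literature.LinearAlgebra.Matrix

universe u

namespace TanCert

/-- Row code `r ↦ (s₁, s₂, s₃, j, l') ∈ (Fin n)³ × Fin b × Fin c`,
`r = (((s₁ n + s₂) n + s₃) b + j) c + l'` (all digits read mod their base).
[cite: DolezalekMichalek2026, §3 (before Cor 3.9)] -/
def rowDec (n b c : ℕ) [NeZero n] [NeZero b] [NeZero c] (r : ℕ) :
    Fin n × Fin n × Fin n × Fin b × Fin c :=
  (finCode n (r / (n * n * b * c)), finCode n (r / (n * b * c)), finCode n (r / (b * c)),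
    finCode b (r / c), finCode c r)

/-- Column code `q ↦ (d, j', l) ∈ Fin n × Fin b × Fin c`, `q = (d b + j') c + l`.
[cite: DolezalekMichalek2026, §3 (before Cor 3.9)] -/
def colDec (n b c : ℕ) [NeZero n] [NeZero b] [NeZero c] (q : ℕ) : Fin n × Fin b × Fin c :=
  (finCode n (q / (b * c)), finCode b (q / c), finCode c q)

/-- Entry `(r, q)` (codes) of the tangency flattening of the integer tensor `T` with its first factor
restricted to the `n` selected slices `sel` (`x ↦ T (sel[x] mod a, ·, ·)`, missing entries read as `0`).
[cite: DolezalekMichalek2026, §3 (before Cor 3.9)] -/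
def tanEntry (n a b c : ℕ) [NeZero n] [NeZero a] [NeZero b] [NeZero c] (sel : List ℕ)
    (T : Fin a → Fin b → Fin c → ℤ) (r q : ℕ) : ℤ :=
  tangencyFlattening (fun (x : Fin n) j l => T (finCode a (sel.getD x 0)) j l)
    (rowDec n b c r) (colDec n b c q)

/-- **Tangency certificate ⇒ `R ≤ bR`**, characteristic zero: an integer row certificate for
`rank Tang ≥ m` of the restricted tensor with `(R - 1)(R - 2)(n - 2) < m` gives `R ≤ bR(T ⊗ K)`
(`le_rank_of_intTriCheck`, base change `tangencyFlattening_map`,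
`le_algBorderRank_of_lt_rank_tangencyFlattening`, `algBorderRank_precomp_le`).
[cite: DolezalekMichalek2026, Cor 3.9] -/
theorem le_algBorderRank_of_tanCheck (K : Type u) [Field K] [CharZero K] (n : ℕ) [NeZero n]
    {a b c : ℕ} [NeZero a] [NeZero b] [NeZero c] (sel : List ℕ) (T : Fin a → Fin b → Fin c → ℤ)
    {m R : ℕ} {rows : List (List (ℕ × ℤ))} {piv : List ℕ}
    (h : intTriCheck m (tanEntry n a b c sel T) rows piv = true)
    (hR : (R - 1) * (R - 2) * (n - 2) < m) :
    R ≤ algBorderRank (fun i j l => (T i j l : K)) := by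
  have e : tanEntry n a b c sel T = fun r q =>
      tangencyFlattening (fun (x : Fin n) j l => T (finCode a (sel.getD x 0)) j l)
        (rowDec n b c r) (colDec n b c q) := rfl
  rw [e] at h
  have hr := le_rank_of_intTriCheck (F := K)
    (tangencyFlattening fun (x : Fin n) j l => T (finCode a (sel.getD x 0)) j l)
    (rowDec n b c) (colDec n b c) h
  have em : (tangencyFlattening fun (x : Fin n) j l => T (finCode a (sel.getD x 0)) j l).map
      (Int.cast : ℤ → K) =
      tangencyFlattening (fun (x : Fin n) j l => (T (finCode a (sel.getD x 0)) j l : K)) := by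
    have hm := tangencyFlattening_map (Int.castRingHom K)
      (fun (x : Fin n) j l => T (finCode a (sel.getD x 0)) j l)
    rw [Int.coe_castRingHom] at hm
    exact hm
  rw [em] at hr
  have h1 : R ≤ algBorderRank (fun (x : Fin n) j l => (T (finCode a (sel.getD x 0)) j l : K)) := by
    refine le_algBorderRank_of_lt_rank_tangencyFlattening _ ?_
    rw [Fintype.card_fin]
    exact lt_of_lt_of_le (by exact_mod_cast hR) hr
  exact h1.trans (algBorderRank_precomp_le (fun i j l => (T i j l : K))
    (fun x : Fin n => finCode a (sel.getD x 0)) (fun j => j) (fun l => l))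

/-- **Tangency certificate ⇒ `R ≤ bR`**, every field (unit pivots).
[cite: DolezalekMichalek2026, Cor 3.9] -/
theorem le_algBorderRank_of_tanCheckUnit (K : Type u) [Field K] (n : ℕ) [NeZero n]
    {a b c : ℕ} [NeZero a] [NeZero b] [NeZero c] (sel : List ℕ) (T : Fin a → Fin b → Fin c → ℤ)
    {m R : ℕ} {rows : List (List (ℕ × ℤ))} {piv : List ℕ}
    (h : intTriCheckUnit m (tanEntry n a b c sel T) rows piv = true)
    (hR : (R - 1) * (R - 2) * (n - 2) < m) :
    R ≤ algBorderRank (fun i j l => (T i j l : K)) := by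
  have e : tanEntry n a b c sel T = fun r q =>
      tangencyFlattening (fun (x : Fin n) j l => T (finCode a (sel.getD x 0)) j l)
        (rowDec n b c r) (colDec n b c q) := rfl
  rw [e] at h
  have hr := le_rank_of_intTriCheckUnit (F := K)
    (tangencyFlattening fun (x : Fin n) j l => T (finCode a (sel.getD x 0)) j l)
    (rowDec n b c) (colDec n b c) h
  have em : (tangencyFlattening fun (x : Fin n) j l => T (finCode a (sel.getD x 0)) j l).map
      (Int.cast : ℤ → K) =
      tangencyFlattening (fun (x : Fin n) j l => (T (finCode a (sel.getD x 0)) j l : K)) := by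
    have hm := tangencyFlattening_map (Int.castRingHom K)
      (fun (x : Fin n) j l => T (finCode a (sel.getD x 0)) j l)
    rw [Int.coe_castRingHom] at hm
    exact hm
  rw [em] at hr
  have h1 : R ≤ algBorderRank (fun (x : Fin n) j l => (T (finCode a (sel.getD x 0)) j l : K)) := by
    refine le_algBorderRank_of_lt_rank_tangencyFlattening _ ?_
    rw [Fintype.card_fin]
    exact lt_of_lt_of_le (by exact_mod_cast hR) hr
  exact h1.trans (algBorderRank_precomp_le (fun i j l => (T i j l : K))
    (fun x : Fin n => finCode a (sel.getD x 0)) (fun j => j) (fun l => l))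

/-! ## Dense form (the restricted tensor read positionally from a list) -/

/-- The tensor `Fin n → Fin b → Fin c → ℤ` read positionally from the list `Tl` (entry `(x, j, l)` at position
`(x b + j) c + l`, missing entries `0`). [folklore] -/
def denseT (n b c : ℕ) (Tl : List ℤ) : Fin n → Fin b → Fin c → ℤ :=
  fun x j l => Tl.getD ((x.val * b + j.val) * c + l.val) 0

/-- Entry `(r, q)` (codes as in `tanEntry`) of the tangency flattening of the dense tensor `denseT n b c Tl`.
[cite: DolezalekMichalek2026, §3 (before Cor 3.9)] -/
def tanEntryL (n b c : ℕ) [NeZero n] [NeZero b] [NeZero c] (Tl : List ℤ) (r q : ℕ) : ℤ :=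
  tangencyFlattening (denseT n b c Tl) (rowDec n b c r) (colDec n b c q)

/-- **Dense tangency certificate ⇒ `R ≤ bR`**, characteristic zero: as `le_algBorderRank_of_tanCheck`, with the
restricted tensor supplied as a dense list `Tl` agreeing entrywise (`hT`, decidable) with the selected slices
`sel` of `T`. [cite: DolezalekMichalek2026, Cor 3.9] -/
theorem le_algBorderRank_of_tanCheckL (K : Type u) [Field K] [CharZero K] (n : ℕ) [NeZero n]
    {a b c : ℕ} [NeZero a] [NeZero b] [NeZero c] (sel : List ℕ) (T : Fin a → Fin b → Fin c → ℤ)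
    {Tl : List ℤ} {m R : ℕ} {rows : List (List (ℕ × ℤ))} {piv : List ℕ}
    (h : intTriCheck m (tanEntryL n b c Tl) rows piv = true)
    (hT : ∀ (x : Fin n) (j : Fin b) (l : Fin c), denseT n b c Tl x j l = T (finCode a (sel.getD x 0)) j l)
    (hR : (R - 1) * (R - 2) * (n - 2) < m) :
    R ≤ algBorderRank (fun i j l => (T i j l : K)) := by
  have hT' : denseT n b c Tl = fun (x : Fin n) j l => T (finCode a (sel.getD x 0)) j l :=
    funext fun x => funext fun j => funext fun l => hT x j l
  have e : tanEntryL n b c Tl = tanEntry n a b c sel T := by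
    funext r q
    show tangencyFlattening (denseT n b c Tl) (rowDec n b c r) (colDec n b c q) = _
    rw [hT']
    rfl
  rw [e] at h
  exact le_algBorderRank_of_tanCheck K n sel T h hR

/-- **Dense tangency certificate ⇒ `R ≤ bR`**, every field (unit pivots).
[cite: DolezalekMichalek2026, Cor 3.9] -/
theorem le_algBorderRank_of_tanCheckLUnit (K : Type u) [Field K] (n : ℕ) [NeZero n]
    {a b c : ℕ} [NeZero a] [NeZero b] [NeZero c] (sel : List ℕ) (T : Fin a → Fin b → Fin c → ℤ)
    {Tl : List ℤ} {m R : ℕ} {rows : List (List (ℕ × ℤ))} {piv : List ℕ}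
    (h : intTriCheckUnit m (tanEntryL n b c Tl) rows piv = true)
    (hT : ∀ (x : Fin n) (j : Fin b) (l : Fin c), denseT n b c Tl x j l = T (finCode a (sel.getD x 0)) j l)
    (hR : (R - 1) * (R - 2) * (n - 2) < m) :
    R ≤ algBorderRank (fun i j l => (T i j l : K)) := by
  have hT' : denseT n b c Tl = fun (x : Fin n) j l => T (finCode a (sel.getD x 0)) j l :=
    funext fun x => funext fun j => funext fun l => hT x j l
  have e : tanEntryL n b c Tl = tanEntry n a b c sel T := by
    funext r q
    show tangencyFlattening (denseT n b c Tl) (rowDec n b c r) (colDec n b c q) = _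
    rw [hT']
    rfl
  rw [e] at h
  exact le_algBorderRank_of_tanCheckUnit K n sel T h hR

end TanCert

end Literature.Computability.AlgebraicComplexity
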